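import Summits.BirchSwinnertonDyer.Rank1Residual.X2.GreenbergVatsalSelmerEqualityCited
import Literature.NumberTheory.EllipticCurves.GreenbergVatsal2000.NonPrimitiveSelmerGroup
import HarnessLib

/-!
# `Sel^{Σ₀}_E(ℚ_∞)_p = S^{Σ₀}_{E[p^∞]}(ℚ_∞)` (Greenberg–Vatsal 2000, p. 26: "the nonprimitive Selmer
# groups also coincide"), in the kernel modulo the printed local statement at `p`

HONEST FRAMING (BSD rank-`≤ 1` residual cell `b2b-bsdres`, home
`run/shared/lean/b2b/bsd-rank1-residual/`, unit `b2b-bsdres-eisenstein-p2`, class X2; research route,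
no claim beyond stated classes): the cell deletes the COMBINATION-SHAPED residual classes of the
rank-`≤ 1` BSD formula from PUBLISHED theorems only and TYPES the construction-shaped ones; this is
not "finishing BSD". Theorems only (no definition, no named fact, nothing asserted). The link between Greenberg–Vatsal's printed non-primitive Selmer group
`Sel^{Σ₀}_E(ℚ_∞)_p` (classical Kummer conditions away from `Σ₀`;
`Literature/…/GreenbergVatsal2000/NonPrimitiveSelmerGroup.lean`, `nonPrimitiveSelmerInfty`) and the
objects of the cell's kernel:

* §1 `nonPrimitiveSelmerGroupOver_le_gvSelmer`, `nonPrimitiveSelmerInfty_le_gvSelmerInfty_reductionData`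
  — `Sel^{Σ₀}_E(L) ⊆ S^{Σ₀}_{E[p^∞]}(L)` (gen 9's `GreenbergVatsalSelmerLink.selmerGroupOver_le_gvSelmer`
  place by place, now needing the Kummer conditions only away from `Σ₀`);
* §2 **`nonPrimitiveSelmerInfty_eq_gvSelmerInfty_of_le`** / **`nonPrimitiveSelmerInfty_eq_gvSelmerInfty`**
  — for `E/ℚ` globally minimal, `p` ODD good ordinary, `κ` cyclotomic, `Σ₀ ⊇` bad primes:
  `Sel^{Σ₀}_E(ℚ_∞)_p = S^{Σ₀}_{E[p^∞]}(ℚ_∞)` (`gvSelmerInfty κ E[p^∞] reductionData Σ₀`, the object of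
  the kernel transfer `GreenbergVatsalTransferCurve.natCard_gvSelmerInfty_inf_torsion_eq_of_torsionIso`),
  GV p. 26 — gen 10's `selmerInfty_eq_gvSelmerInfty_inf` WITHOUT the conditions at `Σ₀` on either
  side; conditional (like gen 10) only on the printed local statement at `p`,
  `GreenbergVatsal2000.imKummer_ge_greenbergCondition_at_p` (GV p. 26 ← Greenberg Props. 2.2/2.4);
(The existence of the `Λ`-module `Hom(Sel^{Σ₀}_E(K_∞)_p, ℚ/ℤ)` as a `NonPrimitiveDualData` is the
sibling file `X2/NonPrimitiveSelmerDual.lean`.) This is step 5 of the kernel derivation of route G's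
typed input `X1.CongruenceTransfer.CongruentLambdaShift` (`X2/CongruentLambdaShiftDerived.lean`).

References: R. Greenberg, V. Vatsal, Invent. Math. 142 (2000), §1 p. 7, §2 pp. 16–17, 19, 26;
R. Greenberg, LNM 1716 (1999), §1 p. 60, §2 pp. 69–75.
-/

noncomputable section

open scoped Classical AddSubgroup

universe u

namespace Summit.BirchSwinnertonDyer.Rank1Residual.X2.NonPrimitiveSelmerGVEquality

open NumberField IsDedekindDomain Field Literature.NumberTheory.GaloisRepresentations
  Literature.NumberTheory.EllipticCurves Literature.NumberTheory.EllipticCurves.GreenbergSelmer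
  Literature.NumberTheory.EllipticCurves.GreenbergVatsal2000
  Summit.BirchSwinnertonDyer.Rank1Residual.X2.GreenbergVatsalTorsion
  Summit.BirchSwinnertonDyer.Rank1Residual.X2.GreenbergVatsalReductionDatum
  Summit.BirchSwinnertonDyer.Rank1Residual.X2.GreenbergVatsalSelmerEquality
  Summit.BirchSwinnertonDyer.Rank1Residual.X2.GreenbergVatsalSelmerEqualityCited
  Summit.BirchSwinnertonDyer.Rank1Residual.X2.GreenbergVatsalSelmerLink
  Summit.BirchSwinnertonDyer.Rank1Residual.X2.GreenbergVatsalUnramifiedAway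

/-! ## §1. `Sel^{Σ₀}_E(L)_p ⊆ S^{Σ₀}_{E[p^∞]}(L)` -/

section Link

variable {K : Type u} [Field K] [NumberField K] (W : WeierstrassCurve K) [W.IsElliptic] (p : ℕ)
  [Fact p.Prime] (H : Subgroup (absoluteGaloisGroup K)) [H.Normal]
  (L : Data K (W.geomPrimaryTorsion p) p) (S₀ : Set (HeightOneSpectrum (𝓞 K)))

omit [Fact p.Prime] in
/-- **`Sel^{Σ₀}_E(L)_p ⊆ S^{Σ₀}_{E[p^∞]}(L)`**: the NON-PRIMITIVE classical Selmer group (Kummer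
conditions at the places not above `Σ₀`) lies in Greenberg–Vatsal's non-primitive Greenberg Selmer
group, for `Σ₀ ⊇` the bad places prime to `p` and any Greenberg datum with the Kummer compatibility
above `p` — place by place as `GreenbergVatsalSelmerLink.selmerGroupOver_le_gvSelmer`: at good
`v ∉ Σ₀`, `v ∤ p` `localKerOver ≤ unramKer`; at `v ∣ p` `localKerOver ≤ greenbergKer`.
[cite: GreenbergVatsal2000, §2 p. 19 and p. 26] [cite: GreenbergLNM1716, §2 pp. 69–70] -/
theorem nonPrimitiveSelmerGroupOver_le_gvSelmer (hS₀ : ∀ v ∈ S₀, ((p : ℕ) : 𝓞 K) ∉ v.asIdeal)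
    (hS : ∀ v : HeightOneSpectrum (𝓞 K), v ∉ S₀ → ((p : ℕ) : 𝓞 K) ∉ v.asIdeal →
      W.HasGoodReductionAt v)
    (hL : ∀ (v : HeightOneSpectrum (𝓞 K)) (hv : ((p : ℕ) : 𝓞 K) ∈ v.asIdeal),
      ∀ σ ∈ absInertia (v.adicCompletion K), ∀ (P : localPoints W (v.adicCompletion K))
        (m : W.geomPrimaryTorsion p),
        pointsMap W (v.adicCompletion K) (m : W.geomPoints) = σ • P - P → m ∈ (L v hv).plus) :
    nonPrimitiveSelmerGroupOver W p H S₀ ≤ gvSelmer H (W.geomPrimaryTorsion p) p L S₀ := by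
  intro c hc
  rw [mem_nonPrimitiveSelmerGroupOver_iff] at hc
  rw [mem_gvSelmer_iff]
  refine ⟨fun v hv hpv σ ↦ localKerOver_le_unramKer W p H (hS v hv hpv) hpv (hc.1 v hv σ),
    fun v hv σ ↦ localKerOver_le_greenbergKer W p H (L v hv) (hL v hv) (hc.1 v ?_ σ)⟩
  exact fun hvS ↦ hS₀ v hvS hv

end Link

section LinkRat

variable (W : WeierstrassCurve ℚ) [W.IsElliptic] [W.IsGloballyMinimal] (p : ℕ) [Fact p.Prime]
  (κ : ZpExtension ℚ p) (S₀ : Set (HeightOneSpectrum (𝓞 ℚ)))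

/-- **`Sel^{Σ₀}_E(ℚ_∞)_p ⊆ S^{Σ₀}_{E[p^∞]}(ℚ_∞)`** for Greenberg's data `C_p = ker(E[p^∞] → Ẽ)` of a
globally minimal `E/ℚ` at a good prime `p ∉ Σ₀`, `Σ₀ ⊇` the bad primes (Kummer compatibility:
`reductionData_kummer`). [cite: GreenbergVatsal2000, §2 p. 19 and p. 26] -/
theorem nonPrimitiveSelmerInfty_le_gvSelmerInfty_reductionData
    (hΔ : ¬ (p : ℤ) ∣ W.minimalDiscriminantInt)
    (hS₀ : ∀ v ∈ S₀, ((p : ℕ) : 𝓞 ℚ) ∉ v.asIdeal)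
    (hS : ∀ v : HeightOneSpectrum (𝓞 ℚ), v ∉ S₀ → ((p : ℕ) : 𝓞 ℚ) ∉ v.asIdeal →
      W.HasGoodReductionAt v) :
    nonPrimitiveSelmerInfty W κ S₀ ≤
      gvSelmerInfty κ (W.geomPrimaryTorsion p) (reductionData W p hΔ) S₀ :=
  fun _ hc ↦ nonPrimitiveSelmerGroupOver_le_gvSelmer W p κ.kerSubgroup (reductionData W p hΔ) S₀
    hS₀ hS (reductionData_kummer W p hΔ) hc

/-! ## §2. `Sel^{Σ₀}_E(ℚ_∞)_p = S^{Σ₀}_{E[p^∞]}(ℚ_∞)` (GV p. 26) -/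

/-- **`Sel^{Σ₀}_E(ℚ_∞)_p = S^{Σ₀}_{E[p^∞]}(ℚ_∞)`, modulo `L_𝔭 ⊆ im κ_𝔭`.** `E/ℚ` globally minimal,
`p` ODD and good (`p ∤ Δ_E`), `p ∉ Σ₀`, `κ` the CYCLOTOMIC `ℤ_p`-extension, `Σ₀ ⊇` the bad primes,
Greenberg's data `reductionData`; hypothesis `hp`: at the place above `p`, Greenberg's condition
implies the Kummer condition (PRINTED: GV p. 26 ← Greenberg Props. 2.2, 2.4). Then GV's printed
non-primitive Selmer group `Sel^{Σ₀}_E(ℚ_∞)_p` (`nonPrimitiveSelmerInfty`: Kummer conditions at every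
place of `ℚ_∞` not above `Σ₀`) IS `S^{Σ₀}_{E[p^∞]}(ℚ_∞)` (`gvSelmerInfty`: unramified at good
`v ∉ Σ₀ ∪ {p}`, Greenberg's condition at `p`). `⊆`: §1; `⊇`: at good `v ∉ Σ₀ ∪ {p}` GV p. 17 in
the kernel (`conjH1_mem_localKerOver_of_mem_gvSelmerInfty_of_isCyclotomic`), at `∞` vacuous for odd
`p` (`localKerOver_completion_eq_top_of_odd`), at `p` by `hp`. This is GV p. 26 "The nonprimitive
Selmer groups `Sel^{Σ₀}_E(ℚ_∞)_p` and `S^{Σ₀}_A(ℚ_∞)` also coincide".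
[cite: GreenbergVatsal2000, §2 pp. 17, 26] [cite: GreenbergLNM1716, §2 pp. 69–75] -/
theorem nonPrimitiveSelmerInfty_eq_gvSelmerInfty_of_le (hp2 : p ≠ 2)
    (hΔ : ¬ (p : ℤ) ∣ W.minimalDiscriminantInt) (hκ : κ.IsCyclotomic)
    (hS₀ : ∀ v ∈ S₀, ((p : ℕ) : 𝓞 ℚ) ∉ v.asIdeal)
    (hS : ∀ v : HeightOneSpectrum (𝓞 ℚ), v ∉ S₀ → ((p : ℕ) : 𝓞 ℚ) ∉ v.asIdeal →
      W.HasGoodReductionAt v)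
    (hp : ∀ (v : HeightOneSpectrum (𝓞 ℚ)) (hv : ((p : ℕ) : 𝓞 ℚ) ∈ v.asIdeal),
      (reductionData W p hΔ v hv).greenbergKer κ.kerSubgroup ≤
        W.localKerOver p κ.kerSubgroup (v.adicCompletion ℚ)) :
    nonPrimitiveSelmerInfty W κ S₀ =
      gvSelmerInfty κ (W.geomPrimaryTorsion p) (reductionData W p hΔ) S₀ := by
  apply le_antisymm (nonPrimitiveSelmerInfty_le_gvSelmerInfty_reductionData W p κ S₀ hΔ hS₀ hS)
  intro c hgv
  change c ∈ nonPrimitiveSelmerGroupOver W p κ.kerSubgroup S₀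
  rw [mem_nonPrimitiveSelmerGroupOver_iff]
  refine ⟨fun v hvS σ ↦ ?_, fun w σ ↦ ?_⟩
  · by_cases hpv : ((p : ℕ) : 𝓞 ℚ) ∈ v.asIdeal
    · exact hp v hpv (((mem_gvSelmer_iff c).1 hgv).2 v hpv σ)
    · exact conjH1_mem_localKerOver_of_mem_gvSelmerInfty_of_isCyclotomic (κ := κ) (v := v)
        (W := W) (p := p) hκ (reductionData W p hΔ) S₀ hgv hvS (hS v hvS hpv) hpv σ
  · rw [localKerOver_completion_eq_top_of_odd W p hp2]
    exact AddSubgroup.mem_top _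

/-- **`Sel^{Σ₀}_E(ℚ_∞)_p = S^{Σ₀}_{E[p^∞]}(ℚ_∞)` at a good ORDINARY odd `p`, CONDITIONAL on the printed
local statement `GreenbergVatsal2000.imKummer_ge_greenbergCondition_at_p`** (GV p. 26 / Greenberg
Props. 2.2, 2.4; hypothesis `hGV`, as in gen 10's `selmerInfty_eq_gvSelmerInfty_inf`); every other
ingredient is a tree theorem. [cite: GreenbergVatsal2000, §2 pp. 17, 26]
[cite: GreenbergLNM1716, §2 Props. 2.2, 2.4 (pp. 73–75)] -/
theorem nonPrimitiveSelmerInfty_eq_gvSelmerInfty (hGV : imKummer_ge_greenbergCondition_at_p)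
    (hp2 : p ≠ 2) (hΔ : ¬ (p : ℤ) ∣ W.minimalDiscriminantInt)
    (hord : ¬ (p : ℤ) ∣ W.frobeniusTrace p) (hκ : κ.IsCyclotomic)
    (hS₀ : ∀ v ∈ S₀, ((p : ℕ) : 𝓞 ℚ) ∉ v.asIdeal)
    (hS : ∀ v : HeightOneSpectrum (𝓞 ℚ), v ∉ S₀ → ((p : ℕ) : 𝓞 ℚ) ∉ v.asIdeal →
      W.HasGoodReductionAt v) :
    nonPrimitiveSelmerInfty W κ S₀ =
      gvSelmerInfty κ (W.geomPrimaryTorsion p) (reductionData W p hΔ) S₀ :=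
  nonPrimitiveSelmerInfty_eq_gvSelmerInfty_of_le W p κ S₀ hp2 hΔ hκ hS₀ hS
    (fun v hv ↦ greenbergKer_reductionData_le_localKerOver W p κ hGV hΔ hord hκ v hv)

/-- **The `p`-torsion of `Sel^{Σ₀}_E(ℚ_∞)_p` IS the corrected object of the kernel transfer**:
under the same hypotheses, `Sel^{Σ₀}_E(ℚ_∞)_p[p]` is in bijection with
`S^{Σ₀}_{E[p^∞]}(ℚ_∞) ⊓ H¹(ℚ_∞, E[p^∞])[p]` (the two sides of
`GreenbergVatsalTransferCurve.natCard_gvSelmerInfty_inf_torsion_eq_of_torsionIso`), so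
`#Sel^{Σ₀}_E(ℚ_∞)_p[p] = #(S^{Σ₀} ⊓ H¹[p])`. [cite: GreenbergVatsal2000, §2 pp. 26–27] -/
theorem natCard_torsionBy_nonPrimitiveSelmerInfty_eq (hGV : imKummer_ge_greenbergCondition_at_p)
    (hp2 : p ≠ 2) (hΔ : ¬ (p : ℤ) ∣ W.minimalDiscriminantInt)
    (hord : ¬ (p : ℤ) ∣ W.frobeniusTrace p) (hκ : κ.IsCyclotomic)
    (hS₀ : ∀ v ∈ S₀, ((p : ℕ) : 𝓞 ℚ) ∉ v.asIdeal)
    (hS : ∀ v : HeightOneSpectrum (𝓞 ℚ), v ∉ S₀ → ((p : ℕ) : 𝓞 ℚ) ∉ v.asIdeal →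
      W.HasGoodReductionAt v) :
    Nat.card ((nonPrimitiveSelmerInfty W κ S₀)[(p : ℤ)]) =
      Nat.card (gvSelmerInfty κ (W.geomPrimaryTorsion p) (reductionData W p hΔ) S₀ ⊓
        (subgroupH1 κ.kerSubgroup (W.geomPrimaryTorsion p))[(p : ℤ)] :
        AddSubgroup (subgroupH1 κ.kerSubgroup (W.geomPrimaryTorsion p))) := by
  have heq := nonPrimitiveSelmerInfty_eq_gvSelmerInfty W p κ S₀ hGV hp2 hΔ hord hκ hS₀ hS
  refine Nat.card_congr (Equiv.ofBijective
    (fun x ↦ ⟨((x : nonPrimitiveSelmerInfty W κ S₀) : subgroupH1 κ.kerSubgroup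
        (W.geomPrimaryTorsion p)), ?_⟩) ⟨?_, ?_⟩)
  · have hx1 : ((x : nonPrimitiveSelmerInfty W κ S₀) : subgroupH1 κ.kerSubgroup
        (W.geomPrimaryTorsion p)) ∈
        gvSelmerInfty κ (W.geomPrimaryTorsion p) (reductionData W p hΔ) S₀ := by
      rw [← heq]; exact (x : nonPrimitiveSelmerInfty W κ S₀).2
    refine AddSubgroup.mem_inf.2 ⟨hx1, AddSubgroup.torsionBy.nsmul_iff.mpr ?_⟩
    have hx : p • (x : nonPrimitiveSelmerInfty W κ S₀) = 0 := by
      exact_mod_cast AddSubgroup.torsionBy.nsmul x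
    exact_mod_cast congrArg (fun t : nonPrimitiveSelmerInfty W κ S₀ ↦
      (t : subgroupH1 κ.kerSubgroup (W.geomPrimaryTorsion p))) hx
  · intro x y hxy
    exact Subtype.ext (Subtype.ext (by simpa using congrArg Subtype.val hxy))
  · intro y
    obtain ⟨hy1, hy2⟩ := AddSubgroup.mem_inf.1 y.2
    have hy2' : p • (y : subgroupH1 κ.kerSubgroup (W.geomPrimaryTorsion p)) = 0 :=
      AddSubgroup.torsionBy.nsmul_iff.mp hy2
    have hy1' : (y : subgroupH1 κ.kerSubgroup (W.geomPrimaryTorsion p)) ∈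
        nonPrimitiveSelmerInfty W κ S₀ := by
      rw [heq]; exact hy1
    refine ⟨⟨⟨y, hy1'⟩, AddSubgroup.torsionBy.nsmul_iff.mpr (Subtype.ext ?_)⟩, rfl⟩
    rw [AddSubgroupClass.coe_nsmul]
    exact hy2'

end LinkRat


end Summit.BirchSwinnertonDyer.Rank1Residual.X2.NonPrimitiveSelmerGVEquality

end
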